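import Summits.KontsevichZagierPeriods.KontsevichZagierPeriods.Theorems.SoloInformedCylinderNLRat
import HarnessLib
import HarnessLib.Audit

/-!
# SoloInformed — the separable Newton–Leibniz descent in every dimension

Solo programme `solo-KontsevichZagierPeriods-informed`, session s112, file 39.

For ANY base representation `r₀ = [D, h]` of dimension `n` (`D ⊆ ℝⁿ` `ℚ`-semialgebraic, `h`
`ℚ`-semialgebraic), `K`-polynomial bounds `a ≤ b` on `D` (`a, b ∈ K[x₁,…,xₙ]`) and `G ∈ K[X]`:
`[{(x, y) : x ∈ D, a(x) ≤ y ≤ b(x)}, h(x)·G'(y)] − [D, h(x)·(G(b(x)) − G(a(x)))] ∈ relations`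
— one move of rule (3) with primitive `F(x, y) = h(x) G(y)` (`soloInformed_separableNL_mem_relations`;
semialgebraicity of `F` from `IsSemialgebraicFunOn.comp_init` and LEMMA ALG-COEFF).  Consequently span
membership DESCENDS along separable bands in every dimension (`soloInformed_segSpan_of_separableNL`),
and iterating, every box integral `∫_{D×[p₁,q₁]×⋯×[p_k,q_k]} h(x) G₁'(y₁)⋯G_k'(y_k)` with `[D, c·h]` in
one of the one-variable classes satisfies the period conjecture against the weight-one classes
(`soloInformed_kzp_separableNL`).  Unconditional.

References: M. Kontsevich, D. Zagier, *Periods* (2001), §1.2 rule (3); this work.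
-/

noncomputable section

open scoped BigOperators Polynomial

namespace Summit.KontsevichZagierPeriods.KontsevichZagierPeriods.Theorems

open Set MeasureTheory
open Literature.ModelTheory.ExponentialFields
open Literature.NumberTheory.Transcendental Literature.NumberTheory.Transcendental.KZ

/-- **The separable Newton–Leibniz move (any dimension).** [Kontsevich–Zagier 2001, §1.2 rule (3)] -/
theorem soloInformed_separableNL_mem_relations {n : ℕ} (r : IntegralRep (n + 1)) (r₀ r₁ : IntegralRep n)
    (hD : r₁.domain ⊆ r₀.domain)
    (a b : MvPolynomial (Fin n) (algebraicClosure ℚ ℝ)) (G : (algebraicClosure ℚ ℝ)[X])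
    (hab : ∀ x ∈ r₁.domain, (MvPolynomial.aeval x a : ℝ) ≤ MvPolynomial.aeval x b)
    (hdom : r.domain = {z | (Fin.init z : Fin n → ℝ) ∈ r₁.domain ∧
      (MvPolynomial.aeval (Fin.init z : Fin n → ℝ) a : ℝ) ≤ z (Fin.last n) ∧
      z (Fin.last n) ≤ MvPolynomial.aeval (Fin.init z : Fin n → ℝ) b})
    (hf : ∀ z ∈ r.domain, r.integrand z =
      r₀.integrand (Fin.init z) * Polynomial.aeval (z (Fin.last n)) (Polynomial.derivative G))
    (hf₁ : ∀ x ∈ r₁.domain, r₁.integrand x = r₀.integrand x *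
      ((Polynomial.aeval (MvPolynomial.aeval x b : ℝ) G : ℝ) - Polynomial.aeval (MvPolynomial.aeval x a : ℝ) G)) :
    of r - of r₁ ∈ relations := by
  have hK := soloInformed_isAlgebraic_algebraMap_K
  have haX : ∀ (P : (algebraicClosure ℚ ℝ)[X]) (z : Fin (n + 1) → ℝ),
      (MvPolynomial.aeval z (Polynomial.aeval (MvPolynomial.X (Fin.last n) :
        MvPolynomial (Fin (n + 1)) (algebraicClosure ℚ ℝ)) P) : ℝ) = Polynomial.aeval (z (Fin.last n)) P :=
    fun P z => by rw [← Polynomial.aeval_algHom_apply, MvPolynomial.aeval_X]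
  set F : (Fin (n + 1) → ℝ) → ℝ := fun z => r₀.integrand (Fin.init z) *
    Polynomial.aeval (z (Fin.last n)) G with hFdef
  set fa : (Fin n → ℝ) → ℝ := fun x => MvPolynomial.aeval x a with hfadef
  set fb : (Fin n → ℝ) → ℝ := fun x => MvPolynomial.aeval x b with hfbdef
  have hFsnoc : ∀ (x : Fin n → ℝ) (t : ℝ), F (Fin.snoc x t) = r₀.integrand x * Polynomial.aeval t G :=
    fun x t => by
    simp only [hFdef, Fin.init_snoc, Fin.snoc_last]
  have hmem : ∀ x ∈ r₁.domain, ∀ t, fa x ≤ t → t ≤ fb x → (Fin.snoc x t : Fin (n + 1) → ℝ) ∈ r.domain :=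
    fun x hx t h1 h2 => by
    rw [hdom]
    refine ⟨?_, ?_, ?_⟩
    · rw [Fin.init_snoc]; exact hx
    · rw [Fin.init_snoc, Fin.snoc_last]; exact h1
    · rw [Fin.init_snoc, Fin.snoc_last]; exact h2
  have hsub : r.domain ⊆ {z : Fin (n + 1) → ℝ | (Fin.init z : Fin n → ℝ) ∈ r₀.domain} := fun z hz => by
    rw [hdom] at hz; exact hD hz.1
  have hF : IsSemialgebraicFunOn ℚ r.domain F := by
    have h1 : IsSemialgebraicFunOn ℚ r.domain fun z => r₀.integrand (Fin.init z) :=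
      r₀.isSemialgebraicFunOn_integrand.comp_init.mono hsub r.isSemialgebraic_domain
    have h2 : IsSemialgebraicFunOn ℚ r.domain fun z => (Polynomial.aeval (z (Fin.last n)) G : ℝ) :=
      (soloInformed_isSemialgebraicFunOn_aevalK hK r.isSemialgebraic_domain
        (Polynomial.aeval (MvPolynomial.X (Fin.last n) : MvPolynomial (Fin (n + 1)) (algebraicClosure ℚ ℝ))
          G)).congr fun z _ => by simp only [haX]
    exact (IsSemialgebraicFunOn.mul_holds h1 h2).congr fun z _ => by simp only [hFdef, Pi.mul_apply]
  have ha : IsSemialgebraicFunOn ℚ r₁.domain fa :=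
    (soloInformed_isSemialgebraicFunOn_aevalK hK r₁.isSemialgebraic_domain a).congr fun x _ => by
      simp only [hfadef]
  have hb : IsSemialgebraicFunOn ℚ r₁.domain fb :=
    (soloInformed_isSemialgebraicFunOn_aevalK hK r₁.isSemialgebraic_domain b).congr fun x _ => by
      simp only [hfbdef]
  refine newtonLeibnizRel_subset_relations ⟨n, r, r₁, fa, fb, F, hF, ha, hb, hab, ?_, ?_, ?_, ?_, rfl⟩
  · rw [hdom]
  · intro x hx
    have hc : Continuous fun t : ℝ => r₀.integrand x * Polynomial.aeval t G :=
      continuous_const.mul (Polynomial.continuous_aeval G)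
    exact hc.continuousOn.congr fun t _ => hFsnoc x t
  · intro x hx t ht
    have hfun : (fun s : ℝ => F (Fin.snoc x s)) = fun s => r₀.integrand x * Polynomial.aeval s G :=
      funext fun s => hFsnoc x s
    rw [hfun, hf _ (hmem x hx t ht.1.le ht.2.le), Fin.init_snoc, Fin.snoc_last]
    exact (Polynomial.hasDerivAt_aeval G t).const_mul _
  · intro x hx
    rw [hf₁ x hx, hFsnoc, hFsnoc]
    ring

/-- **Span membership descends along separable bands (any dimension):** if the boundary
representation `r₁ = [D, h·(G∘b − G∘a)]` lies in the span of points and segments, so does the band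
representation `r`, and the two are KZ-equivalent. -/
theorem soloInformed_segSpan_of_separableNL {n : ℕ} (r : IntegralRep (n + 1)) (r₀ r₁ : IntegralRep n)
    (hD : r₁.domain ⊆ r₀.domain)
    (a b : MvPolynomial (Fin n) (algebraicClosure ℚ ℝ)) (G : (algebraicClosure ℚ ℝ)[X])
    (hab : ∀ x ∈ r₁.domain, (MvPolynomial.aeval x a : ℝ) ≤ MvPolynomial.aeval x b)
    (hdom : r.domain = {z | (Fin.init z : Fin n → ℝ) ∈ r₁.domain ∧
      (MvPolynomial.aeval (Fin.init z : Fin n → ℝ) a : ℝ) ≤ z (Fin.last n) ∧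
      z (Fin.last n) ≤ MvPolynomial.aeval (Fin.init z : Fin n → ℝ) b})
    (hf : ∀ z ∈ r.domain, r.integrand z =
      r₀.integrand (Fin.init z) * Polynomial.aeval (z (Fin.last n)) (Polynomial.derivative G))
    (hf₁ : ∀ x ∈ r₁.domain, r₁.integrand x = r₀.integrand x *
      ((Polynomial.aeval (MvPolynomial.aeval x b : ℝ) G : ℝ) - Polynomial.aeval (MvPolynomial.aeval x a : ℝ) G))
    (h₁ : of r₁ ∈ soloInformedSegSpan) :
    of r ∈ soloInformedSegSpan ∧ Equivalent r r₁ := by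
  have hrel := soloInformed_separableNL_mem_relations r r₀ r₁ hD a b G hab hdom hf hf₁
  have h : of r ∈ soloInformedSegSpan := soloInformed_mem_segSpan_of_sub_mem hrel h₁
  have hv : r.value = r₁.value := by
    have h0 : eval (of r - of r₁) = 0 := relations_le_ker_eval_holds hrel
    rw [map_sub, eval_of, eval_of] at h0
    exact sub_eq_zero.1 h0
  exact ⟨h, soloInformed_equivalent_of_mem_segSpan h h₁ hv⟩

/-- **The period conjecture along separable bands (any dimension).**  With the data above and the
boundary representation in the span (e.g. elementary, an elementary sum, Chebyshev–Euler, a lower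
band …): the band representation `r` is KZ-equivalent to every elementary sum, every Chebyshev–Euler
integral, every rational representation of dimension `≤ 1` and every span member of the same value.
Unconditional. [Kontsevich–Zagier 2001, §1.2; this work] -/
theorem soloInformed_kzp_separableNL {n : ℕ} (r : IntegralRep (n + 1)) (r₀ r₁ : IntegralRep n)
    (hD : r₁.domain ⊆ r₀.domain)
    (a b : MvPolynomial (Fin n) (algebraicClosure ℚ ℝ)) (G : (algebraicClosure ℚ ℝ)[X])
    (hab : ∀ x ∈ r₁.domain, (MvPolynomial.aeval x a : ℝ) ≤ MvPolynomial.aeval x b)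
    (hdom : r.domain = {z | (Fin.init z : Fin n → ℝ) ∈ r₁.domain ∧
      (MvPolynomial.aeval (Fin.init z : Fin n → ℝ) a : ℝ) ≤ z (Fin.last n) ∧
      z (Fin.last n) ≤ MvPolynomial.aeval (Fin.init z : Fin n → ℝ) b})
    (hf : ∀ z ∈ r.domain, r.integrand z =
      r₀.integrand (Fin.init z) * Polynomial.aeval (z (Fin.last n)) (Polynomial.derivative G))
    (hf₁ : ∀ x ∈ r₁.domain, r₁.integrand x = r₀.integrand x *
      ((Polynomial.aeval (MvPolynomial.aeval x b : ℝ) G : ℝ) - Polynomial.aeval (MvPolynomial.aeval x a : ℝ) G))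
    (h₁ : of r₁ ∈ soloInformedSegSpan) :
    (∀ r₂ : IntegralRep 1, SoloInformedIsKElementarySumOne r₂ → r.value = r₂.value → Equivalent r r₂) ∧
    (∀ {m : ℕ} (hm : m ≠ 0) (r₂ : IntegralRep 1), SoloInformedIsKMobiusRadicalOne m r₂ →
      r.value = r₂.value → Equivalent r r₂) ∧
    (∀ {d : ℕ} (hd : d ≤ 1) (r' : IntegralRep d), r'.IsRational → r.value = r'.value →
      Equivalent r r') ∧
    (∀ {k : ℕ} (r₂ : IntegralRep k), of r₂ ∈ soloInformedSegSpan → r.value = r₂.value →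
      Equivalent r r₂) := by
  have h := (soloInformed_segSpan_of_separableNL r r₀ r₁ hD a b G hab hdom hf hf₁ h₁).1
  exact ⟨fun r₂ hr₂ hv => soloInformed_equivalent_of_mem_segSpan h
      (soloInformed_segSpan_of_isKElementarySumOne r₂ hr₂) hv,
    fun hm r₂ hr₂ hv => soloInformed_equivalent_of_mem_segSpan h
      (soloInformed_segSpan_of_isKMobiusRadicalOne hm r₂ hr₂) hv,
    fun hd r' hr' hv => soloInformed_equivalent_of_mem_segSpan h
      (soloInformed_of_mem_segSpan_of_isRational hd r' hr') hv,
    fun r₂ hr₂ hv => soloInformed_equivalent_of_mem_segSpan h hr₂ hv⟩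

end Summit.KontsevichZagierPeriods.KontsevichZagierPeriods.Theorems
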